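import Summits.BirchSwinnertonDyer.BirchSwinnertonDyer.Theorems.AdditiveKolyvaginRoadRamifiedHabitatSignLawField
import Summits.BirchSwinnertonDyer.BirchSwinnertonDyer.Theorems.AdditiveKolyvaginRoadRamifiedHabitatPStarTwistStarred
import HarnessLib

/-!
# Route `AdditiveKolyvaginRoad`, crux KS′ `LevelKolyvaginSystemsAdditive` (stmt-BirchSwinnertonDyer-21396), card `ramified-toric-habitat` —
# part 6: the sign-law assembly with the LOCAL DATA AT `p` AS HYPOTHESES, and the ramified-habitat sign law for the STARRED types IV*, III*, II*

Cell `pub/bsd-wall`, width seat `bsd-wall-akr-p2x-w2` g11; `--supports stmt-BirchSwinnertonDyer-21396` (helper). THEOREMS ONLY; no definition,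
no named fact, no `sorry`. BSD is not proved by any of this; KS′/KPA′ stay OPEN at `p² ∣ N`.

* `rootNumber_mul_rootNumber_pStarTwist_of_localData`, `rootNumber_mul_rootNumber_ramifiedTwist_of_localData` — parts 2–3 re-assembled
  with part 1's OUTPUT as hypotheses (both minimal models at `p` additive, `W_p(E)·W_p(E^{(p*)}) = r`):
  `w(E)·w(E^{(p*)}) = (M/p)·r` and, in the habitat (`d = p*·d'`, other bad primes split), **`w(E)·w(E^{(d)}) = −(−1/p)·r`** — the tree
  form of `w(E)w(E^{(d_K)}) = −(−1/p)·w_p(E)·w_p(E^{(d_K)})`. Any local table at `p` plugs in here.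
* `rootNumber_mul_rootNumber_ramifiedTwist_of_ge` (+ `_eq_one_of_not_dvd`, `_eq_neg_one_of_dvd`, and the field forms
  `rootNumber_mul_rootNumber_twist_discr_of_ge_eq_one_of_not_dvd` / `_eq_neg_one_of_dvd`) — the law for Kodaira types IV*, III*, II* at `p`
  (`ord_p Δ_min = a ∈ {8,9,10}`, `e = 12/gcd(12,a) = 3, 4, 6`), by part 5's local table: `+1` iff `e ∤ p − 1`, `−1` iff `e ∣ p − 1`.

With parts 3–4 (types II, III, IV) this covers EVERY additive potentially good `p ≥ 5` with `e ∈ {3, 4, 6}` — all the supercuspidal cells of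
the card (`e ∤ p − 1` forces `e ∈ {3,4,6}`) and the potentially good principal-series cells except `e = 2` (type I₀*, where `E^{(p*)}` is GOOD at
`p` and the bookkeeping is the tree's `atkinLehnerEigenvalueAt_eq_localRootNumberAt_of_twist`; not treated). Scope otherwise as in part 3:
`E` semistable away from `p` (`N = M p²`, `M` squarefree), `d` odd; CONDITIONAL on the Modularity Theorem and Kellock–Dokchitser's Rem. 2.2 at `p`.

References: [cite: MurtyMurty1997, Ch. 6 §1] [cite: Rohrlich1993Compositio, Prop. 2(iv)] [cite: KellockDokchitser2023, Rem. 2.2] [cite: Knapp1993, Thm. 9.27].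
-/

set_option autoImplicit false
set_option linter.dupNamespace false

noncomputable section

open scoped Classical MatrixGroups

open CongruenceSubgroup IsDedekindDomain IsDedekindDomain.HeightOneSpectrum NumberField Rat.HeightOneSpectrum
  WeierstrassCurve Literature.NumberTheory.EllipticCurves Literature.NumberTheory.EllipticCurves.ModularForms
  IsDiscreteValuationRing

namespace Summit.BirchSwinnertonDyer.BirchSwinnertonDyer.Theorems.AdditiveKoly.RamifiedHabitat

/-! ## §7 The assembly with the local data at `p` as hypotheses, and the sign law for the starred types -/

section Starred

open scoped NumberTheorySymbols

variable {p : ℕ} [Fact p.Prime]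

/-- **`w(E)·w(E^{(p*)}) = (M/p)·r` from the local data at `p`.** As `rootNumber_mul_rootNumber_pStarTwist`, but with part 1's output —
both minimal models at `p` ADDITIVE and `W_p(E)·W_p(E^{(p*)}) = r` — taken as hypotheses, so that any branch of the local computation
(types II/III/IV, part 1; IV*/III*/II*, part 5) can be plugged in. Conditional on the Modularity Theorem and Kellock–Dokchitser's Rem. 2.2
at `p` for `E`, `E^{(p*)}`. [cite: Knapp1993, Thm. 9.27] [cite: KellockDokchitser2023, Rem. 2.2] -/
theorem rootNumber_mul_rootNumber_pStarTwist_of_localData (W : WeierstrassCurve ℚ) [W.IsElliptic] (hmod : exists_isNewformOf)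
    (hF1 : W.atkinLehnerEigenvalueAt_eq_localRootNumberAt)
    (hF1' : (W.quadraticTwist (((-1 : ℤ) ^ (p / 2) * p : ℤ) : ℚ)).atkinLehnerEigenvalueAt_eq_localRootNumberAt)
    (hp5 : 5 ≤ p) {M : ℕ} (hN : W.conductorNorm ℤ = M * p ^ 2) (hM : Squarefree M) (hpM : ¬ p ∣ M)
    (hadd : ((W.baseChange ℚ_[p]).minimal ℤ_[p]).HasAdditiveReduction ℤ_[p])
    (hadd' : (((W.quadraticTwist (((-1 : ℤ) ^ (p / 2) * p : ℤ) : ℚ)).baseChange ℚ_[p]).minimal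
      ℤ_[p]).HasAdditiveReduction ℤ_[p]) {r : ℤ}
    (hprod : (W.baseChange ℚ_[p]).localRootNumber ℤ_[p] *
      ((W.quadraticTwist (((-1 : ℤ) ^ (p / 2) * p : ℤ) : ℚ)).baseChange ℚ_[p]).localRootNumber ℤ_[p] = r) :
    W.rootNumber * (W.quadraticTwist (((-1 : ℤ) ^ (p / 2) * p : ℤ) : ℚ)).rootNumber = legendreSym p M * r := by
  have hp : p.Prime := Fact.out
  have hp2 : p ≠ 2 := by omega
  have hdZ0 : ((-1 : ℤ) ^ (p / 2) * p : ℤ) ≠ 0 :=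
    mul_ne_zero (pow_ne_zero _ (by norm_num)) (by exact_mod_cast hp.ne_zero)
  have hd0 : (((((-1 : ℤ) ^ (p / 2) * p : ℤ)) : ℚ)) ≠ 0 := by exact_mod_cast hdZ0
  haveI hE' : (W.quadraticTwist (((-1 : ℤ) ^ (p / 2) * p : ℤ) : ℚ)).IsElliptic := W.isElliptic_quadraticTwist hd0
  haveI : NeZero (W.conductorNorm ℤ) := ⟨(W.conductorNorm_pos_holds).ne'⟩
  haveI : NeZero ((W.quadraticTwist (((-1 : ℤ) ^ (p / 2) * p : ℤ) : ℚ)).conductorNorm ℤ) :=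
    ⟨((W.quadraticTwist _).conductorNorm_pos_holds).ne'⟩
  have hN' : (W.quadraticTwist (((-1 : ℤ) ^ (p / 2) * p : ℤ) : ℚ)).conductorNorm ℤ = M * p ^ 2 :=
    (conductorNorm_pStarTwist_eq W hp5 hadd hadd').trans hN
  obtain ⟨f, hf⟩ := hmod W
  obtain ⟨f', hf'⟩ := hmod (W.quadraticTwist (((-1 : ℤ) ^ (p / 2) * p : ℤ) : ℚ))
  have h0 := rootNumber_mul_rootNumber_pStarTwist_eq_legendreSym_mul W hp2 hN hM hpM hN' hf hf'
  set P : Nat.Primes := ⟨p, hp⟩ with hP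
  have hgen : natGenerator ((primesEquiv (R := ℤ)).symm P) = p :=
    congrArg (fun q : Nat.Primes ↦ (q : ℕ)) ((primesEquiv (R := ℤ)).apply_symm_apply P)
  have h23 : ∀ V : WeierstrassCurve ℚ, V.HasAdditiveReductionAt ((primesEquiv (R := ℤ)).symm P) →
      3 < ringChar (ℤ ⧸ ((primesEquiv (R := ℤ)).symm P).asIdeal) := fun _ _ ↦ by
    rw [Rat.ringChar_int_quotient_asIdeal, hgen]; omega
  have hPN : (P : ℕ) ∣ W.conductorNorm ℤ := by
    change p ∣ _; rw [hN]; exact ⟨M * p, by ring⟩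
  have hPN' : (P : ℕ) ∣ (W.quadraticTwist (((-1 : ℤ) ^ (p / 2) * p : ℤ) : ℚ)).conductorNorm ℤ := by
    change p ∣ _; rw [hN']; exact ⟨M * p, by ring⟩
  have hl : atkinLehnerEigenvalueAt f p = ((W.baseChange ℚ_[p]).localRootNumber ℤ_[p] : ℂ) := by
    rw [← localRootNumberAt_primesEquiv_symm_holds W P]
    exact hF1 hf P hPN (h23 W)
  have hl' : atkinLehnerEigenvalueAt f' p =
      (((W.quadraticTwist (((-1 : ℤ) ^ (p / 2) * p : ℤ) : ℚ)).baseChange ℚ_[p]).localRootNumber ℤ_[p] : ℂ) := by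
    rw [← localRootNumberAt_primesEquiv_symm_holds _ P]
    exact hF1' hf' P hPN' (h23 _)
  rw [hl, hl', ← Int.cast_mul, hprod] at h0
  exact_mod_cast h0

/-- **`w(E)·w(E^{(d)}) = −(−1/p)·r` from the local data at `p`** (`d = p*·d'`, habitat hypotheses as in
`rootNumber_mul_rootNumber_ramifiedTwist`): the ramified-habitat sign ratio with part 1's output as hypotheses — both minimal models at
`p` additive and `W_p(E)·W_p(E^{(p*)}) = r`. This is the tree form of the identity `w(E)w(E^{(d_K)}) = −(−1/p)·w_p(E)·w_p(E^{(d_K)})`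
(the tree's `RAMIFIED-HABITAT-SIGNLAW-NOTE.md` on the crux). Conditional on {hmod, F1 at `p`}.
[cite: MurtyMurty1997, Ch. 6 §1] [cite: KellockDokchitser2023, Rem. 2.2] -/
theorem rootNumber_mul_rootNumber_ramifiedTwist_of_localData (W : WeierstrassCurve ℚ) [W.IsElliptic]
    (hmod : exists_isNewformOf) (hF1 : W.atkinLehnerEigenvalueAt_eq_localRootNumberAt)
    (hF1' : (W.quadraticTwist (((-1 : ℤ) ^ (p / 2) * p : ℤ) : ℚ)).atkinLehnerEigenvalueAt_eq_localRootNumberAt)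
    (hp5 : 5 ≤ p) {M : ℕ} (hN : W.conductorNorm ℤ = M * p ^ 2) (hM : Squarefree M) (hpM : ¬ p ∣ M)
    (hadd : ((W.baseChange ℚ_[p]).minimal ℤ_[p]).HasAdditiveReduction ℤ_[p])
    (hadd' : (((W.quadraticTwist (((-1 : ℤ) ^ (p / 2) * p : ℤ) : ℚ)).baseChange ℚ_[p]).minimal
      ℤ_[p]).HasAdditiveReduction ℤ_[p]) {r : ℤ}
    (hprod : (W.baseChange ℚ_[p]).localRootNumber ℤ_[p] *
      ((W.quadraticTwist (((-1 : ℤ) ^ (p / 2) * p : ℤ) : ℚ)).baseChange ℚ_[p]).localRootNumber ℤ_[p] = r)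
    {d' : ℤ} (hd'4 : d' % 4 = 1) (hd'sq : Squarefree d') (hgcd : Int.gcd d' (W.conductorNorm ℤ) = 1)
    (hneg : (-1 : ℤ) ^ (p / 2) * p * d' < 0)
    (hodd : ∀ q ∈ M.primeFactors, q ≠ 2 → J((-1 : ℤ) ^ (p / 2) * p * d' | q) = 1)
    (htwo : 2 ∣ M → ((-1 : ℤ) ^ (p / 2) * p * d') % 8 = 1) :
    W.rootNumber * (W.quadraticTwist (((-1 : ℤ) ^ (p / 2) * p * d' : ℤ) : ℚ)).rootNumber = -ZMod.χ₄ p * r := by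
  have hp : p.Prime := Fact.out
  have hp2 : p ≠ 2 := by omega
  have hdZ0 : ((-1 : ℤ) ^ (p / 2) * p : ℤ) ≠ 0 :=
    mul_ne_zero (pow_ne_zero _ (by norm_num)) (by exact_mod_cast hp.ne_zero)
  have hd0 : (((((-1 : ℤ) ^ (p / 2) * p : ℤ)) : ℚ)) ≠ 0 := by exact_mod_cast hdZ0
  haveI hE' : (W.quadraticTwist (((-1 : ℤ) ^ (p / 2) * p : ℤ) : ℚ)).IsElliptic := W.isElliptic_quadraticTwist hd0
  have hA := rootNumber_mul_rootNumber_pStarTwist_of_localData W hmod hF1 hF1' hp5 hN hM hpM hadd hadd' hprod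
  have hN' : (W.quadraticTwist (((-1 : ℤ) ^ (p / 2) * p : ℤ) : ℚ)).conductorNorm ℤ = M * p ^ 2 :=
    (conductorNorm_pStarTwist_eq W hp5 hadd hadd').trans hN
  have hgcd' : Int.gcd d' ((W.quadraticTwist (((-1 : ℤ) ^ (p / 2) * p : ℤ) : ℚ)).conductorNorm ℤ) = 1 := by
    rw [hN', ← hN]; exact hgcd
  have hB := ((W.quadraticTwist (((-1 : ℤ) ^ (p / 2) * p : ℤ) : ℚ)).rootNumber_quadraticTwist_of_emod_four_eq_one
    hmod hd'4 hd'sq hgcd').1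
  rw [quadraticTwist_quadraticTwist, hN'] at hB
  have hcast : ((((-1 : ℤ) ^ (p / 2) * p : ℤ) : ℚ)) * (d' : ℚ) = (((-1 : ℤ) ^ (p / 2) * p * d' : ℤ) : ℚ) := by push_cast; ring
  rw [hcast] at hB
  have hNe0 : NeZero d'.natAbs := ⟨Int.natAbs_ne_zero.mpr (by rintro rfl; norm_num at hd'4)⟩
  have hJM : J(((M * p ^ 2 : ℕ) : ℤ) | d'.natAbs) = legendreSym p M := by
    rw [Nat.cast_mul, jacobiSym.mul_left, jacobiSym_natAbs_eq_legendreSym_of_split hp2 hd'4 hM hodd htwo, Nat.cast_pow,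
      jacobiSym.sq_one', mul_one]
    rw [Int.gcd_natCast_natCast]
    have h1 : Nat.Coprime d'.natAbs (W.conductorNorm ℤ) := by
      have := hgcd; unfold Int.gcd at this; simpa using this
    have hpN : p ∣ W.conductorNorm ℤ := by rw [hN]; exact ⟨M * p, by ring⟩
    exact (Nat.Coprime.coprime_dvd_right hpN h1).symm
  have hJ1 := jacobiSym_neg_one_natAbs_eq_of_neg hp2 hd'4 hneg
  have hM2 : legendreSym p M * legendreSym p M = 1 := by
    rw [← sq]
    refine legendreSym.sq_one p ?_
    rw [Int.cast_natCast, ne_eq, ZMod.natCast_eq_zero_iff]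
    exact hpM
  calc W.rootNumber * (W.quadraticTwist (((-1 : ℤ) ^ (p / 2) * p * d' : ℤ) : ℚ)).rootNumber
      = J(-1 | d'.natAbs) * J(((M * p ^ 2 : ℕ) : ℤ) | d'.natAbs) *
          (W.rootNumber * (W.quadraticTwist (((-1 : ℤ) ^ (p / 2) * p : ℤ) : ℚ)).rootNumber) := by rw [hB]; ring
    _ = -ZMod.χ₄ p * legendreSym p M * (legendreSym p M * r) := by rw [hJ1, hJM, hA]
    _ = -ZMod.χ₄ p * r := by linear_combination (-(ZMod.χ₄ ↑p) * r) * hM2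

/-- **THE RAMIFIED-HABITAT SIGN RATIO, STARRED TYPES.** As `rootNumber_mul_rootNumber_ramifiedTwist` but for Kodaira types IV*, III*, II*
at `p` (`ord_p Δ_min = a ∈ {8, 9, 10}`, `e = 12/gcd(12,a) = 3, 4, 6`): `w(E)·w(E^{(d)}) = −(−1/p)` (`e = 4`), `= −(−3/p)` (`e ∈ {3,6}`).
Conditional on {hmod, F1 at `p`}. [cite: Rohrlich1993Compositio, Prop. 2(iv)] [cite: KellockDokchitser2023, Rem. 2.2] -/
theorem rootNumber_mul_rootNumber_ramifiedTwist_of_ge (W : WeierstrassCurve ℚ) [W.IsElliptic] (hmod : exists_isNewformOf)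
    (hF1 : W.atkinLehnerEigenvalueAt_eq_localRootNumberAt)
    (hF1' : (W.quadraticTwist (((-1 : ℤ) ^ (p / 2) * p : ℤ) : ℚ)).atkinLehnerEigenvalueAt_eq_localRootNumberAt)
    (hp5 : 5 ≤ p) {M : ℕ} (hN : W.conductorNorm ℤ = M * p ^ 2) (hM : Squarefree M) (hpM : ¬ p ∣ M) {a : ℕ}
    (hΔ : addVal ℤ_[p] (((W.baseChange ℚ_[p]).minimal ℤ_[p]).integralModel ℤ_[p]).Δ = a)
    (ha : a = 8 ∨ a = 9 ∨ a = 10)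
    (hc₄ : addVal ℤ_[p] (((W.baseChange ℚ_[p]).minimal ℤ_[p]).integralModel ℤ_[p]).c₄ ≠ 0)
    (hj : ¬ 3 * addVal ℤ_[p] (((W.baseChange ℚ_[p]).minimal ℤ_[p]).integralModel ℤ_[p]).c₄ <
      addVal ℤ_[p] (((W.baseChange ℚ_[p]).minimal ℤ_[p]).integralModel ℤ_[p]).Δ)
    {d' : ℤ} (hd'4 : d' % 4 = 1) (hd'sq : Squarefree d') (hgcd : Int.gcd d' (W.conductorNorm ℤ) = 1)
    (hneg : (-1 : ℤ) ^ (p / 2) * p * d' < 0)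
    (hodd : ∀ q ∈ M.primeFactors, q ≠ 2 → J((-1 : ℤ) ^ (p / 2) * p * d' | q) = 1)
    (htwo : 2 ∣ M → ((-1 : ℤ) ^ (p / 2) * p * d') % 8 = 1) :
    W.rootNumber * (W.quadraticTwist (((-1 : ℤ) ^ (p / 2) * p * d' : ℤ) : ℚ)).rootNumber =
      if a = 9 then -ZMod.χ₄ p else -(if p % 3 = 1 then 1 else -1) := by
  have hp2 : p ≠ 2 := by omega
  obtain ⟨hadd, hadd', hprod⟩ := localRootNumber_mul_pStarTwist_padic_of_ge W hp5 hΔ ha hc₄ hj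
  rw [rootNumber_mul_rootNumber_ramifiedTwist_of_localData W hmod hF1 hF1' hp5 hN hM hpM hadd hadd' hprod hd'4 hd'sq hgcd hneg
    hodd htwo]
  have hχ₄ : ZMod.χ₄ p * ZMod.χ₄ p = 1 := by
    have hp' := (Nat.Prime.eq_two_or_odd (Fact.out : p.Prime)).resolve_left hp2
    rw [ZMod.χ₄_nat_eq_if_mod_four]
    have : p % 4 = 1 ∨ p % 4 = 3 := by omega
    have h2' : p % 2 ≠ 0 := by omega
    rcases this with h | h <;> simp [h, h2']
  split_ifs
  · ring
  · linear_combination -hχ₄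
  · linear_combination hχ₄

/-- **SUPERCUSPIDAL HALF, STARRED TYPES** (`e ∤ p − 1 ⟹ w(E)·w(E^{(d)}) = +1`; `e := 12/gcd(12,a)`, `a ∈ {8,9,10}`).
Conditional on {hmod, F1 at `p`}. [cite: Rohrlich1993Compositio, Prop. 2(iv)] [cite: KellockDokchitser2023, Rem. 2.2] -/
theorem rootNumber_mul_rootNumber_ramifiedTwist_of_ge_eq_one_of_not_dvd (W : WeierstrassCurve ℚ) [W.IsElliptic]
    (hmod : exists_isNewformOf) (hF1 : W.atkinLehnerEigenvalueAt_eq_localRootNumberAt)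
    (hF1' : (W.quadraticTwist (((-1 : ℤ) ^ (p / 2) * p : ℤ) : ℚ)).atkinLehnerEigenvalueAt_eq_localRootNumberAt)
    (hp5 : 5 ≤ p) {M : ℕ} (hN : W.conductorNorm ℤ = M * p ^ 2) (hM : Squarefree M) (hpM : ¬ p ∣ M) {a : ℕ}
    (hΔ : addVal ℤ_[p] (((W.baseChange ℚ_[p]).minimal ℤ_[p]).integralModel ℤ_[p]).Δ = a)
    (ha : a = 8 ∨ a = 9 ∨ a = 10)
    (hc₄ : addVal ℤ_[p] (((W.baseChange ℚ_[p]).minimal ℤ_[p]).integralModel ℤ_[p]).c₄ ≠ 0)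
    (hj : ¬ 3 * addVal ℤ_[p] (((W.baseChange ℚ_[p]).minimal ℤ_[p]).integralModel ℤ_[p]).c₄ <
      addVal ℤ_[p] (((W.baseChange ℚ_[p]).minimal ℤ_[p]).integralModel ℤ_[p]).Δ)
    {d' : ℤ} (hd'4 : d' % 4 = 1) (hd'sq : Squarefree d') (hgcd : Int.gcd d' (W.conductorNorm ℤ) = 1)
    (hneg : (-1 : ℤ) ^ (p / 2) * p * d' < 0)
    (hodd : ∀ q ∈ M.primeFactors, q ≠ 2 → J((-1 : ℤ) ^ (p / 2) * p * d' | q) = 1)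
    (htwo : 2 ∣ M → ((-1 : ℤ) ^ (p / 2) * p * d') % 8 = 1)
    (hsc : ¬ 12 / Nat.gcd a 12 ∣ p - 1) :
    W.rootNumber * (W.quadraticTwist (((-1 : ℤ) ^ (p / 2) * p * d' : ℤ) : ℚ)).rootNumber = 1 := by
  rw [rootNumber_mul_rootNumber_ramifiedTwist_of_ge W hmod hF1 hF1' hp5 hN hM hpM hΔ ha hc₄ hj hd'4 hd'sq hgcd hneg hodd htwo]
  have hp' := (Nat.Prime.eq_two_or_odd (Fact.out : p.Prime)).resolve_left (by omega)
  rcases ha with rfl | rfl | rfl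
  · have e3 : 12 / Nat.gcd 8 12 = 3 := by decide
    rw [e3] at hsc
    have h3 : p % 3 ≠ 1 := fun h ↦ hsc (by omega)
    simp [h3]
  · have e4 : 12 / Nat.gcd 9 12 = 4 := by decide
    rw [e4] at hsc
    have h4 : p % 4 = 3 := by omega
    simp [ZMod.χ₄_nat_three_mod_four h4]
  · have e6 : 12 / Nat.gcd 10 12 = 6 := by decide
    rw [e6] at hsc
    have h3 : p % 3 ≠ 1 := fun h ↦ hsc (by omega)
    simp [h3]

/-- **PRINCIPAL-SERIES HALF, STARRED TYPES** (`e ∣ p − 1 ⟹ w(E)·w(E^{(d)}) = −1`, potentially good).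
Conditional on {hmod, F1 at `p`}. [cite: Rohrlich1993Compositio, Prop. 2(iv)] [cite: KellockDokchitser2023, Rem. 2.2] -/
theorem rootNumber_mul_rootNumber_ramifiedTwist_of_ge_eq_neg_one_of_dvd (W : WeierstrassCurve ℚ) [W.IsElliptic]
    (hmod : exists_isNewformOf) (hF1 : W.atkinLehnerEigenvalueAt_eq_localRootNumberAt)
    (hF1' : (W.quadraticTwist (((-1 : ℤ) ^ (p / 2) * p : ℤ) : ℚ)).atkinLehnerEigenvalueAt_eq_localRootNumberAt)
    (hp5 : 5 ≤ p) {M : ℕ} (hN : W.conductorNorm ℤ = M * p ^ 2) (hM : Squarefree M) (hpM : ¬ p ∣ M) {a : ℕ}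
    (hΔ : addVal ℤ_[p] (((W.baseChange ℚ_[p]).minimal ℤ_[p]).integralModel ℤ_[p]).Δ = a)
    (ha : a = 8 ∨ a = 9 ∨ a = 10)
    (hc₄ : addVal ℤ_[p] (((W.baseChange ℚ_[p]).minimal ℤ_[p]).integralModel ℤ_[p]).c₄ ≠ 0)
    (hj : ¬ 3 * addVal ℤ_[p] (((W.baseChange ℚ_[p]).minimal ℤ_[p]).integralModel ℤ_[p]).c₄ <
      addVal ℤ_[p] (((W.baseChange ℚ_[p]).minimal ℤ_[p]).integralModel ℤ_[p]).Δ)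
    {d' : ℤ} (hd'4 : d' % 4 = 1) (hd'sq : Squarefree d') (hgcd : Int.gcd d' (W.conductorNorm ℤ) = 1)
    (hneg : (-1 : ℤ) ^ (p / 2) * p * d' < 0)
    (hodd : ∀ q ∈ M.primeFactors, q ≠ 2 → J((-1 : ℤ) ^ (p / 2) * p * d' | q) = 1)
    (htwo : 2 ∣ M → ((-1 : ℤ) ^ (p / 2) * p * d') % 8 = 1)
    (hps : 12 / Nat.gcd a 12 ∣ p - 1) :
    W.rootNumber * (W.quadraticTwist (((-1 : ℤ) ^ (p / 2) * p * d' : ℤ) : ℚ)).rootNumber = -1 := by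
  rw [rootNumber_mul_rootNumber_ramifiedTwist_of_ge W hmod hF1 hF1' hp5 hN hM hpM hΔ ha hc₄ hj hd'4 hd'sq hgcd hneg hodd htwo]
  have hp' := (Nat.Prime.eq_two_or_odd (Fact.out : p.Prime)).resolve_left (by omega)
  rcases ha with rfl | rfl | rfl
  · have e3 : 12 / Nat.gcd 8 12 = 3 := by decide
    rw [e3] at hps
    have h3 : p % 3 = 1 := by omega
    simp [h3]
  · have e4 : 12 / Nat.gcd 9 12 = 4 := by decide
    rw [e4] at hps
    have h4 : p % 4 = 1 := by omega
    simp [ZMod.χ₄_nat_one_mod_four h4]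
  · have e6 : 12 / Nat.gcd 10 12 = 6 := by decide
    rw [e6] at hps
    have h3 : p % 3 = 1 := by omega
    simp [h3]

/-- **FIELD FORM, STARRED TYPES — supercuspidal half**: `K′` imaginary quadratic, `d_{K′}` odd, `p ∣ d_{K′}`, every prime of `M` split in `K′`;
Kodaira type IV*/III*/II* at `p`. If `e ∤ p − 1` then `w(E)·w(E^{(d_{K′})}) = +1`. Conditional on {hmod, F1 at `p`}; BSD is not proved by this.
[cite: Rohrlich1993Compositio, Prop. 2(iv)] [cite: KellockDokchitser2023, Rem. 2.2] -/
theorem rootNumber_mul_rootNumber_twist_discr_of_ge_eq_one_of_not_dvd (W : WeierstrassCurve ℚ) [W.IsElliptic]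
    (hmod : exists_isNewformOf) (hF1 : W.atkinLehnerEigenvalueAt_eq_localRootNumberAt)
    (hF1' : (W.quadraticTwist (((-1 : ℤ) ^ (p / 2) * p : ℤ) : ℚ)).atkinLehnerEigenvalueAt_eq_localRootNumberAt)
    (hp5 : 5 ≤ p) {M : ℕ} (hN : W.conductorNorm ℤ = M * p ^ 2) (hM : Squarefree M) (hpM : ¬ p ∣ M) {a : ℕ}
    (hΔ : addVal ℤ_[p] (((W.baseChange ℚ_[p]).minimal ℤ_[p]).integralModel ℤ_[p]).Δ = a)
    (ha : a = 8 ∨ a = 9 ∨ a = 10)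
    (hc₄ : addVal ℤ_[p] (((W.baseChange ℚ_[p]).minimal ℤ_[p]).integralModel ℤ_[p]).c₄ ≠ 0)
    (hj : ¬ 3 * addVal ℤ_[p] (((W.baseChange ℚ_[p]).minimal ℤ_[p]).integralModel ℤ_[p]).c₄ <
      addVal ℤ_[p] (((W.baseChange ℚ_[p]).minimal ℤ_[p]).integralModel ℤ_[p]).Δ)
    (K : Type) [Field K] [NumberField K] (hK : IsImaginaryQuadratic K) (hKodd : Odd (NumberField.discr K))
    (hpd : (p : ℤ) ∣ NumberField.discr K)
    (hodd : ∀ q ∈ M.primeFactors, q ≠ 2 → J(NumberField.discr K | q) = 1)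
    (htwo : 2 ∣ M → NumberField.discr K % 8 = 1)
    (hsc : ¬ 12 / Nat.gcd a 12 ∣ p - 1) :
    W.rootNumber * (W.quadraticTwist (NumberField.discr K : ℚ)).rootNumber = 1 := by
  obtain ⟨d', hd, hd'4, hd'sq, hgcd, hneg⟩ := ramifiedHabitat_data_of_discr (by omega) hM K hK hKodd hpd hodd htwo
  rw [hd] at hodd htwo ⊢
  rw [← hN] at hgcd
  exact rootNumber_mul_rootNumber_ramifiedTwist_of_ge_eq_one_of_not_dvd W hmod hF1 hF1' hp5 hN hM hpM hΔ ha hc₄ hj hd'4 hd'sq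
    hgcd hneg hodd htwo hsc

/-- **FIELD FORM, STARRED TYPES — principal-series half** (potentially good): if `e ∣ p − 1` then `w(E)·w(E^{(d_{K′})}) = −1`.
Conditional on {hmod, F1 at `p`}; BSD is not proved by this. [cite: Rohrlich1993Compositio, Prop. 2(iv)] [cite: KellockDokchitser2023, Rem. 2.2] -/
theorem rootNumber_mul_rootNumber_twist_discr_of_ge_eq_neg_one_of_dvd (W : WeierstrassCurve ℚ) [W.IsElliptic]
    (hmod : exists_isNewformOf) (hF1 : W.atkinLehnerEigenvalueAt_eq_localRootNumberAt)
    (hF1' : (W.quadraticTwist (((-1 : ℤ) ^ (p / 2) * p : ℤ) : ℚ)).atkinLehnerEigenvalueAt_eq_localRootNumberAt)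
    (hp5 : 5 ≤ p) {M : ℕ} (hN : W.conductorNorm ℤ = M * p ^ 2) (hM : Squarefree M) (hpM : ¬ p ∣ M) {a : ℕ}
    (hΔ : addVal ℤ_[p] (((W.baseChange ℚ_[p]).minimal ℤ_[p]).integralModel ℤ_[p]).Δ = a)
    (ha : a = 8 ∨ a = 9 ∨ a = 10)
    (hc₄ : addVal ℤ_[p] (((W.baseChange ℚ_[p]).minimal ℤ_[p]).integralModel ℤ_[p]).c₄ ≠ 0)
    (hj : ¬ 3 * addVal ℤ_[p] (((W.baseChange ℚ_[p]).minimal ℤ_[p]).integralModel ℤ_[p]).c₄ <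
      addVal ℤ_[p] (((W.baseChange ℚ_[p]).minimal ℤ_[p]).integralModel ℤ_[p]).Δ)
    (K : Type) [Field K] [NumberField K] (hK : IsImaginaryQuadratic K) (hKodd : Odd (NumberField.discr K))
    (hpd : (p : ℤ) ∣ NumberField.discr K)
    (hodd : ∀ q ∈ M.primeFactors, q ≠ 2 → J(NumberField.discr K | q) = 1)
    (htwo : 2 ∣ M → NumberField.discr K % 8 = 1)
    (hps : 12 / Nat.gcd a 12 ∣ p - 1) :
    W.rootNumber * (W.quadraticTwist (NumberField.discr K : ℚ)).rootNumber = -1 := by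
  obtain ⟨d', hd, hd'4, hd'sq, hgcd, hneg⟩ := ramifiedHabitat_data_of_discr (by omega) hM K hK hKodd hpd hodd htwo
  rw [hd] at hodd htwo ⊢
  rw [← hN] at hgcd
  exact rootNumber_mul_rootNumber_ramifiedTwist_of_ge_eq_neg_one_of_dvd W hmod hF1 hF1' hp5 hN hM hpM hΔ ha hc₄ hj hd'4 hd'sq
    hgcd hneg hodd htwo hps

end Starred

end Summit.BirchSwinnertonDyer.BirchSwinnertonDyer.Theorems.AdditiveKoly.RamifiedHabitat

end
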